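import Mathlib.Analysis.SpecialFunctions.Log.Basic
import Literature.Probability.LatticeModels.CorrelationDecay
import Literature.Probability.LatticeModels.IsingThermodynamics
import HarnessLib

-- provenance: harness21/H21/H21/Prelude/StatMech/IsingExponents.lean @ 6e24e58 (interim HEAD d8f2665); M5 mechanical rewrite
/-!
# Ising critical exponents (StatMech trunk G02, prelude item P7)

Notion `critical_exponents`. The standard critical exponents `β, γ, ν, η, δ` of the
nearest-neighbour Ising model on `ℤ^d`, formalised as *existence-of-limit predicates*
(`Prop`s asserting that a given real number is the exponent), obtained as one-line
specialisations of the model-agnostic power-law predicates of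
`Literature.Prelude.StatMech.CorrelationDecay` to the thermodynamic quantities of
`Literature.Prelude.StatMech.IsingThermodynamics`:

* `HasIsingExponentBeta d b`  : `m*(β) ≈ (β - β_c)^b` as `β ↓ β_c`;
* `HasIsingExponentGamma d γ` : `χ(β) ≈ (β_c - β)^{-γ}` as `β ↑ β_c`;
* `HasIsingExponentNu d ν`    : `ξ(β) ≈ (β_c - β)^{-ν}` as `β ↑ β_c`;
* `HasIsingExponentEta d η`   : `⟨σ₀σ_x⟩_{β_c} ≈ ‖x‖^{-(d-2+η)}` as `x → ∞`, and the two-sided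
  bound `HasIsingEtaBounds d η`;
* `HasIsingExponentDelta d δ` : `m(β_c, h) ≈ h^{1/δ}` as `h ↓ 0`;
* the scaling relations `IsingScalingRelation` (`2Δ_σ = d - 2 + η`), `FisherRelation`
  (`γ = ν(2 - η)`) and `HyperscalingRelation` (`dν = 2 - α`) as plain arithmetic `Prop`s.

All exponents are stated in the weakest standard (logarithmic) sense
`log f(x) / log |x - x₀| → κ`, following Friedli–Velenik §3.10.11; in particular no exponent is
*defined* as a number (which would require choosing junk values when the limit fails to exist).

Sources: M. E. Fisher, *The theory of equilibrium critical phenomena*, Rep. Prog. Phys. 30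
(1967), §§1–2, 5 (definitions of `α, β, γ, δ, ν, η` and the scaling relations);
H. Duminil-Copin, *100 years of the (critical) Ising model on the hypercubic lattice*,
Proc. ICM 2022 (arXiv:2208.00864), §4.2.1, p. 12 (the exponents `α, β, γ, δ, η, ν` and the
scaling relations `νd = 2-α = 2β+γ = β(δ+1)`, `2-η = γ/ν`); J. Cardy, *Scaling and
Renormalization in Statistical Physics* (1996), §3.7 eq. (3.51) `η = d + 2 - 2y_h` and §3.8
eq. (3.55) `x_h = d - y_h` (so `2x_h = d - 2 + η` for the spin scaling dimension `x_h`, here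
`Δ_σ`); S. Friedli, Y. Velenik, *Statistical Mechanics of Lattice Systems* (2017), §3.10.11.

Design choices.
* The dimension is cast to `ℝ` in `d - 2 + η` (no `ℕ` subtraction).
* `susceptibility d β : ℝ≥0∞` is converted with `ENNReal.toReal` (junk `0` when `χ = ∞`, which
  by Aizenman–Barsky–Fernández only happens for `β ≥ β_c`, i.e. outside the filter `𝓝[<] β_c`
  up to the point itself).
* `HasIsingExponentNu` uses the axis correlation length `isingCorrLength` and hence needs
  `[NeZero d]`; all predicates are only meaningful for `2 ≤ d` (see `criticalBeta`).
* Mathlib search: Mathlib has no critical exponents, scaling relations or Ising-specific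
  asymptotics (`rg -i "critical exponent|hyperscaling|Fisher relation"` finds nothing); only
  `Real.log`, `Filter.Tendsto`, `nhdsWithin` are used, via the P4 predicates.
-/

noncomputable section

open Filter Topology

namespace Literature.Probability.LatticeModels

variable (d : ℕ)

/-! ### The exponents `β, γ, ν, η, δ` -/

/-- The Ising model on `ℤ^d` has magnetisation exponent `β = b`: the spontaneous magnetisation
obeys `m*(β) ≈ (β - β_c)^b` as `β ↓ β_c`, in the logarithmic sense
`log m*(β) / log (β - β_c) → b`. (The exponent is called `b` to avoid the clash with the inverse
temperature.) Fisher (1967), §2, eq. (2.4); Duminil-Copin, ICM 2022, §4.2.1;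
Friedli–Velenik (2017), §3.10.11. [cite: Fisher1967] -/
def HasIsingExponentBeta (b : ℝ) : Prop :=
  HasRightPowerLaw (spontaneousMagnetization d) (criticalBeta d) b

/-- The Ising model on `ℤ^d` has susceptibility exponent `γ`: `χ(β) ≈ (β_c - β)^{-γ}` as
`β ↑ β_c`, in the logarithmic sense `log χ(β) / log (β_c - β) → -γ` (with `χ` converted from
`ℝ≥0∞` by `toReal`; it is finite for `β < β_c`). Fisher (1967), §2, eq. (2.6);
Duminil-Copin, ICM 2022, §4.2.1; Friedli–Velenik (2017), §3.10.11. [cite: Fisher1967] -/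
def HasIsingExponentGamma (γ : ℝ) : Prop :=
  HasLeftPowerLaw (fun β => (susceptibility d β).toReal) (criticalBeta d) (-γ)

/-- The Ising model on `ℤ^d` has correlation-length exponent `ν`: `ξ(β) ≈ (β_c - β)^{-ν}` as
`β ↑ β_c`, in the logarithmic sense `log ξ(β) / log (β_c - β) → -ν`, where `ξ` is the axis
correlation length `isingCorrLength` of the plus-state two-point function.
Fisher (1967), §5, eq. (5.7); Duminil-Copin, ICM 2022, §4.2.1; Friedli–Velenik (2017), §3.10.11. [cite: Fisher1967] -/
def HasIsingExponentNu [NeZero d] (ν : ℝ) : Prop :=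
  HasLeftPowerLaw (isingCorrLength d) (criticalBeta d) (-ν)

/-- The Ising model on `ℤ^d` has anomalous-dimension exponent `η`: the critical two-point
function obeys `⟨σ₀ σ_x⟩⁺_{β_c,0} ≈ ‖x‖^{-(d - 2 + η)}` as `x → ∞`, in the logarithmic sense
`log ⟨σ₀σ_x⟩_{β_c} / log ‖x‖ → -(d - 2 + η)` (norm-independent).
Fisher (1967), §5, eq. (5.5); Duminil-Copin, ICM 2022, §4.2.1; Cardy (1996), §3.7
eq. (3.51) (`2x_h = d - 2 + η` for the spin scaling dimension `x_h = Δ_σ`);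
Friedli–Velenik (2017), §3.10.11. [cite: Fisher1967] -/
def HasIsingExponentEta (η : ℝ) : Prop :=
  HasSpatialDecayExponent (criticalTwoPoint d) ((d : ℝ) - 2 + η)

/-- The Ising model on `ℤ^d` has critical-isotherm exponent `δ`: at `β = β_c` the magnetisation
in a field obeys `m(β_c, h) ≈ h^{1/δ}` as `h ↓ 0`, in the logarithmic sense
`log m(β_c, h) / log h → δ⁻¹`. Fisher (1967), §2, eq. (2.5); Duminil-Copin, ICM 2022, §4.2.1;
Friedli–Velenik (2017), §3.10.11. [cite: Fisher1967] -/
def HasIsingExponentDelta (δ : ℝ) : Prop :=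
  HasRightPowerLaw (fun h => magnetizationInField d (criticalBeta d) h) 0 δ⁻¹

/-- Two-sided power-law bounds on the critical two-point function with exponent `η`:
there are constants `0 < c ≤ C` with `c ‖x‖^{-(d-2+η)} ≤ ⟨σ₀ σ_x⟩⁺_{β_c,0} ≤ C ‖x‖^{-(d-2+η)}`
for all `x ≠ 0` (the form in which `η = 0` is known for `d ≥ 5` and `η = 1/4` for `d = 2`).
Duminil-Copin, ICM 2022, §4.2.1; Friedli–Velenik (2017), §3.10.11.
[cite: DuminilCopinICM2022, §4.2.1 p. 12] -/
def HasIsingEtaBounds (η : ℝ) : Prop :=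
  IsPowerBounded (criticalTwoPoint d) ((d : ℝ) - 2 + η)

variable {d}

/-- Two-sided power-law bounds with exponent `η` on the critical two-point function imply that
`η` is the (logarithmic) exponent `η` (sanity check; immediate from
`IsPowerBounded.hasSpatialDecayExponent`). Elementary; cf. Friedli–Velenik (2017), §3.10.11. [cite: FriedliVelenik2017] -/
def HasIsingExponentEta.of_bounded : Prop :=
  ∀ {η : ℝ} (h : HasIsingEtaBounds d η),
    HasIsingExponentEta d η

/- interim proof relied on results that are now named facts (D-0014); demoted to a fact by the M5 import, proof preserved:
:=
  IsPowerBounded.hasSpatialDecayExponent h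
-/

/-- Dot-notation alias of `HasIsingExponentEta.of_bounded`: `HasIsingEtaBounds d η` implies
`HasIsingExponentEta d η`. Elementary; cf. Friedli–Velenik (2017), §3.10.11. [cite: FriedliVelenik2017] -/
def HasIsingEtaBounds.hasIsingExponentEta : Prop :=
  ∀ {η : ℝ} (h : HasIsingEtaBounds d η),
    HasIsingExponentEta d η

/- interim proof relied on results that are now named facts (D-0014); demoted to a fact by the M5 import, proof preserved:
:=
  HasIsingExponentEta.of_bounded h
-/

/-- The exponent `η` is unique when it exists (limits along `cofinite` on `ℤ^d`, `d ≥ 1`, are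
unique since `Site d` is then infinite). Elementary. [folklore] -/
theorem HasIsingExponentEta.unique [NeZero d] {η₁ η₂ : ℝ} (h₁ : HasIsingExponentEta d η₁)
    (h₂ : HasIsingExponentEta d η₂) : η₁ = η₂ := by
  have := neg_injective (tendsto_nhds_unique h₁ h₂)
  linarith

/-- The exponent `β` (here `b`) is unique when it exists. Elementary
(`HasRightPowerLaw.unique`). [folklore] -/
theorem HasIsingExponentBeta.unique {b₁ b₂ : ℝ} (h₁ : HasIsingExponentBeta d b₁)
    (h₂ : HasIsingExponentBeta d b₂) : b₁ = b₂ :=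
  HasRightPowerLaw.unique h₁ h₂

/-- The exponent `γ` is unique when it exists. Elementary (`HasLeftPowerLaw.unique`). [folklore] -/
theorem HasIsingExponentGamma.unique {γ₁ γ₂ : ℝ} (h₁ : HasIsingExponentGamma d γ₁)
    (h₂ : HasIsingExponentGamma d γ₂) : γ₁ = γ₂ :=
  neg_injective (HasLeftPowerLaw.unique h₁ h₂)

/-- The exponent `ν` is unique when it exists. Elementary (`HasLeftPowerLaw.unique`). [folklore] -/
theorem HasIsingExponentNu.unique [NeZero d] {ν₁ ν₂ : ℝ} (h₁ : HasIsingExponentNu d ν₁)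
    (h₂ : HasIsingExponentNu d ν₂) : ν₁ = ν₂ :=
  neg_injective (HasLeftPowerLaw.unique h₁ h₂)

/-- The exponent `δ` is unique when it exists. Elementary (`HasRightPowerLaw.unique` and
injectivity of `x ↦ x⁻¹` on `ℝ`). [folklore] -/
theorem HasIsingExponentDelta.unique {δ₁ δ₂ : ℝ} (h₁ : HasIsingExponentDelta d δ₁)
    (h₂ : HasIsingExponentDelta d δ₂) : δ₁ = δ₂ :=
  inv_injective (HasRightPowerLaw.unique h₁ h₂)

/-! ### Scaling relations -/

/-- The Ising scaling relation between the spin scaling dimension `Δ_σ` and `η` in dimension `d`: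
`2 Δ_σ = d - 2 + η` (so that `⟨σ₀σ_x⟩_{β_c} ≈ ‖x‖^{-2Δ_σ}`).
Cardy (1996), §3.7 eq. (3.51) `η = d + 2 - 2y_h` with §3.8 eq. (3.55) `x_h = d - y_h` (the spin
scaling dimension `x_h`, here `Δ_σ`); `η` as in Fisher (1967), §5 and Duminil-Copin, ICM 2022,
§4.2.1. [cite: Cardy1996, §3.7 eq. (3.51) and §3.8 eq. (3.55)] -/
def IsingScalingRelation (d : ℕ) (Δσ η : ℝ) : Prop :=
  2 * Δσ = (d : ℝ) - 2 + η

/-- Fisher's scaling relation `γ = ν (2 - η)`. Fisher (1967), §5, eq. (5.10);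
Duminil-Copin, ICM 2022, §4.2.1. [cite: Fisher1967] -/
def FisherRelation (γ ν η : ℝ) : Prop :=
  γ = ν * (2 - η)

/-- The (Josephson) hyperscaling relation `d ν = 2 - α` in dimension `d` (expected to hold for
`d ≤ 4` and to fail above the upper critical dimension). Fisher (1967), §5;
Duminil-Copin, ICM 2022, §4.2.1. [cite: Fisher1967] -/
def HyperscalingRelation (d : ℕ) (ν α : ℝ) : Prop :=
  (d : ℝ) * ν = 2 - α

/-- If `η` is the anomalous dimension and `Δ_σ` satisfies the Ising scaling relation, then the
critical two-point function decays with spatial exponent `2 Δ_σ`. Elementary (rewrite). [folklore] -/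
theorem HasIsingExponentEta.hasSpatialDecayExponent_two_mul {η Δσ : ℝ}
    (h : HasIsingExponentEta d η) (hrel : IsingScalingRelation d Δσ η) :
    HasSpatialDecayExponent (criticalTwoPoint d) (2 * Δσ) := by
  unfold IsingScalingRelation at hrel
  rw [hrel]
  exact h

end Literature.Probability.LatticeModels

-- M5: re-elaborated after the full-build coherence check (05:54Z)
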